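import Summits.RiemannHypothesis.RiemannHypothesis.Theorems.TiltedLandingLaw421R3AntiEscapeSplit7
import Summits.RiemannHypothesis.RiemannHypothesis.Theorems.TiltedLandingLaw421StubOffJensenSign
import Summits.RiemannHypothesis.RiemannHypothesis.Theorems.TiltedLandingLaw421R3RateUncoveredR1u
import Summits.RiemannHypothesis.RiemannHypothesis.Theorems.TiltedLandingLaw421R3NestedSign

/-!
# RATE helper — the ISOLATION SIGN (R1uᵀ first lemma, sign/rate half): `Im K_v ≤ −1/(2·Im v)` at a laterally isolated simple zero

TOUCH class, rung R1uᵀ of ⟨33346⟩ `TiltedLandingLaw421R`, route EarlyAppointments (lens-2 O6-c first lemma; director (CA638)/(CA648)/(CA652); W-08 C4 desk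
rh-idea-6 g38 image 67, landing cut g39).  Two namespaces, tree imports only.

`RhW08.NewtonMate` — the MATE-TERM DICTIONARY for the tree's Newton number `newtonK f j v := deriv (dslope f⁽ʲ⁾ v) v / dslope f⁽ʲ⁾ v v`
(`…R3AntiEscapeSplit7`): for `F = (· − v)·h` with `h` differentiable at `v`, `dslope F v = h` (`dslope_linear_mul`), so the Newton field value is
`h′(v)/h(v)`; splitting off the conjugate MATE, `h = (· − v̄)·g`, gives `h′(v)/h(v) = 1/(v − v̄) + g′(v)/g(v)` (`logDeriv_mate_split`) with
`1/(v − v̄) = −i/(2·Im v)` (`mate_term_re`/`mate_term_im`), hence ★ `newtonK_mate`: `K_v = 1/(v − v̄) + g′(v)/g(v)` and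
`im_newtonK_mate`: **`Im K_v = −1/(2·Im v) + Im(g′(v)/g(v))`**, `re_newtonK_mate`: `Re K_v = Re(g′(v)/g(v))` — the «pulls» are the logarithmic
derivative of the REST `g` (partner-free: zoo, far field), no genus / Hadamard input.  `main_term_eq` is the K-2 leading-term identity
`−2·Im v·κ = (1 − 2·Im v·P)/‖K‖²` for `κ = Im K/‖K‖²`, `Im K = −1/(2·Im v) + P`.

`RhW08.IsolationSign` — the SIGN: `im_newtonK_le_of_cofactor` (cofactor field level-or-down at `v`, `Im(g′/g)(v) ≤ 0` ⇒ `Im K_v ≤ −1/(2·Im v)`);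
`offJensenDiscs_of_isolated` (cofactor zeros in the strip `|Im u| ≤ Hs`, `Hs ≤ R/2`, lateral `R/2`-isolation of `v` from the non-real ones ⇒
`StubOffJensenSign.OffJensenDiscs g v`); ★ `im_newtonK_lt_of_isolated` (STRICT `Im K_v < −1/(2·Im v)` for a CLASS cofactor `InClass g Hs` with a zero,
by `offJensenSign_holds`); `im_newtonStep_lt` (`Im K < 0 ⇒ Im(v − 1/K) < Im v`); and, in the `EngineHyps5 2` frame,
★★ **`im_newtonK_le_of_lateral_isolation`**: `EngineHyps5 2 η f x₀ s hmax R Hs B → f⁽ʲ⁾ v = 0 → deriv f⁽ʲ⁾ v ≠ 0 → 0 < Im v →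
(∀ z, f⁽ʲ⁾ z = 0 → |Re z − Re v| < R/2 → z = v ∨ z = v̄) → Im (newtonK f j v) ≤ −(1/(2·Im v))`, with corollary
`newtonChild_below_of_lateral_isolation`: the first-order Newton child `v − 1/K_v` lies strictly below `v`.
Chain (tree names): `RhW08.Column.realEntireLt2_of_hyps` + `RhW08.WindowLoss.realEntireLt2_iteratedDeriv` (class heredity) →
`RhW08.NestedSign.exists_cofactor` (global pair removal keeps the class; `RhW08.IsolatedTilt.pairQ_eq_mul` to the mate form) → simplicity ⇒ `h v ≠ 0`,
Schwarz reflection `Literature.Analysis.Complex.apply_conj_eq_conj` ⇒ `h v̄ ≠ 0` → isolation + strip `RhW08.Column.abs_im_le_of_level` + `2·Hs ≤ R` ⇒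
every zero `a` of `h` has `|Im a| < ‖v − Re a‖` → JENSEN SIGN in value form (zero-free cofactor included) `RhW08.NestedSign.im_mul_im_logDeriv_nonpos`
⇒ `Im v · Im(h′/h)(v) ≤ 0` → `im_newtonK_le_of_cofactor`.
The SIMPLICITY binder `deriv f⁽ʲ⁾ v ≠ 0` is NECESSARY as typed: at a double zero `dslope F v v = F′(v) = 0` and `newtonK` is Lean's junk value `0`,
whose imaginary part is not `≤ −1/(2·Im v)`; it is free on every LIGHT state (`LightWitness (dslope f⁽ʲ⁾ v) v M` ⇒ `dslope f⁽ʲ⁾ v v ≠ 0`, lens-2 l.8145 /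
(CA652)(A)).  Twins in `…R3RateUncoveredSign` (#1176, not imported here to keep the import list at four): `mate_term_im` ↔
`RhW08.UncoveredSign.im_inv_sub_conj_self` (up to `one_div`), `im_newtonStep_lt` = `(RhW08.UncoveredSign.im_newtonStep_lt_iff _).2`.
What it does NOT give (scope of record, (CA652)): the EXISTENCE of an actual zero of `f⁽ʲ⁺¹⁾` near `v − 1/K_v` (K-3b `lowChildAt_of_light_isolated`:
door + located Newton disc + this sign + `lowChildAt_of_disc`), which together with this file settles only the LIGHT ∧ `λ_N > 27` sub-case of
`TouchedLowChildLawJ`; the heavy / low-field remainder of R1uᵀ is law-shaped and open.  Nothing here bears on the truth of RH; RH is not proved;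
R1uᵀ / RUNG-P / ★A / 33346 / 33347 OPEN.
-/

namespace RhW08.NewtonMate

open Complex

/-- `dslope ((· − v)·h) v = h` for `h` differentiable at `v` (off `v` by algebra, at `v` by the product rule). -/
theorem dslope_linear_mul {h : ℂ → ℂ} {v : ℂ} (hh : DifferentiableAt ℂ h v) :
    dslope (fun z => (z - v) * h z) v = h := by
  funext z
  by_cases hz : z = v
  · subst hz
    rw [dslope_same]
    have hd : HasDerivAt (fun w => (w - z) * h w) (1 * h z + (z - z) * deriv h z) z :=
      ((hasDerivAt_id z).sub_const z).mul hh.hasDerivAt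
    rw [hd.deriv]; simp
  · rw [dslope_of_ne _ hz, slope_def_field]
    have hne : z - v ≠ 0 := sub_ne_zero.mpr hz
    simp only [sub_self, zero_mul, sub_zero]
    field_simp

/-- hence the NEWTON FIELD VALUE of `F = (· − v)·h` at `v` is `h′(v)/h(v)`. -/
theorem newtonValue_eq {h : ℂ → ℂ} {v : ℂ} (hh : DifferentiableAt ℂ h v) :
    deriv (dslope (fun z => (z - v) * h z) v) v / dslope (fun z => (z - v) * h z) v v = deriv h v / h v := by
  rw [dslope_linear_mul hh]

/-- logarithmic derivative of a product at a point. -/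
theorem logDeriv_mul_at {u g : ℂ → ℂ} {v : ℂ} (hu : DifferentiableAt ℂ u v) (hg : DifferentiableAt ℂ g v)
    (hu0 : u v ≠ 0) (hg0 : g v ≠ 0) :
    deriv (fun z => u z * g z) v / (u v * g v) = deriv u v / u v + deriv g v / g v := by
  have e : (fun z => u z * g z) = u * g := rfl
  rw [e, (hu.hasDerivAt.mul hg.hasDerivAt).deriv]
  field_simp

/-- `v − v̄ = 2i·Im v`. -/
theorem sub_conj_eq (v : ℂ) : v - (starRingEnd ℂ) v = 2 * (v.im : ℂ) * I :=
  Complex.ext (by simp) (by simp; ring)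

/-- the MATE TERM, real part: `Re (1/(v − v̄)) = 0` (the mate pulls purely vertically). -/
theorem mate_term_re (v : ℂ) : (1 / (v - (starRingEnd ℂ) v)).re = 0 := by
  rw [sub_conj_eq, one_div, Complex.inv_re]
  simp

/-- the MATE TERM, imaginary part: `Im (1/(v − v̄)) = −1/(2·Im v)` for `Im v ≠ 0` (`1/(v − v̄) = −i/(2·Im v)`; twin of the tree's
`RhW08.UncoveredSign.im_inv_sub_conj_self`, which states it for `(v − v̄)⁻¹`). -/
theorem mate_term_im (v : ℂ) (hv : v.im ≠ 0) : (1 / (v - (starRingEnd ℂ) v)).im = -1 / (2 * v.im) := by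
  rw [sub_conj_eq, one_div, Complex.inv_im]
  have h2 : Complex.normSq (2 * (v.im : ℂ) * I) = 4 * v.im ^ 2 := by
    rw [Complex.normSq_apply]; simp; ring
  rw [h2]
  simp
  field_simp
  ring

/-- **`h′(v)/h(v) = 1/(v − v̄) + g′(v)/g(v)`** for `h = (· − v̄)·g`, `g(v) ≠ 0`, `Im v ≠ 0`. -/
theorem logDeriv_mate_split {g : ℂ → ℂ} {v : ℂ} (hv : v.im ≠ 0) (hg : DifferentiableAt ℂ g v) (hg0 : g v ≠ 0) :
    deriv (fun z => (z - (starRingEnd ℂ) v) * g z) v / ((v - (starRingEnd ℂ) v) * g v) =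
      1 / (v - (starRingEnd ℂ) v) + deriv g v / g v := by
  have hu : DifferentiableAt ℂ (fun z : ℂ => z - (starRingEnd ℂ) v) v := differentiableAt_id.sub_const _
  have hu0 : v - (starRingEnd ℂ) v ≠ 0 := by
    rw [sub_conj_eq]
    have : (v.im : ℂ) ≠ 0 := by exact_mod_cast hv
    simp [this, Complex.I_ne_zero]
  rw [logDeriv_mul_at hu hg hu0 hg0]
  have hd : deriv (fun z : ℂ => z - (starRingEnd ℂ) v) v = 1 := by
    rw [((hasDerivAt_id' v).sub_const _).deriv]
  rw [hd]

/-- **«Im K_v = −1/(2 Im v) + pulls»**: for `F = (· − v)·(· − v̄)·g`, the imaginary part of the Newton field value at `v`. -/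
theorem im_newtonValue_mate {g : ℂ → ℂ} {v : ℂ} (hv : v.im ≠ 0) (hg : DifferentiableAt ℂ g v) (hg0 : g v ≠ 0) :
    (deriv (fun z => (z - (starRingEnd ℂ) v) * g z) v / ((v - (starRingEnd ℂ) v) * g v)).im =
      -1 / (2 * v.im) + (deriv g v / g v).im := by
  rw [logDeriv_mate_split hv hg hg0, Complex.add_im, mate_term_im v hv]

/-- the real part: `Re K_v = Re (g′(v)/g(v))` (the mate pulls purely vertically). -/
theorem re_newtonValue_mate {g : ℂ → ℂ} {v : ℂ} (hv : v.im ≠ 0) (hg : DifferentiableAt ℂ g v) (hg0 : g v ≠ 0) :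
    (deriv (fun z => (z - (starRingEnd ℂ) v) * g z) v / ((v - (starRingEnd ℂ) v) * g v)).re = (deriv g v / g v).re := by
  rw [logDeriv_mate_split hv hg hg0, Complex.add_re, mate_term_re v, zero_add]

/-- **THE FULL NEWTON-VALUE DICTIONARY** for `F z = (z − v)·((z − v̄)·g z)`: with `h z := (z − v̄)·g z`,
`deriv (dslope F v) v / dslope F v v = 1/(v − v̄) + g′(v)/g(v)`. -/
theorem newtonValue_mate {g : ℂ → ℂ} {v : ℂ} (hv : v.im ≠ 0) (hg : DifferentiableAt ℂ g v) (hg0 : g v ≠ 0) :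
    deriv (dslope (fun z => (z - v) * ((z - (starRingEnd ℂ) v) * g z)) v) v /
        dslope (fun z => (z - v) * ((z - (starRingEnd ℂ) v) * g z)) v v =
      1 / (v - (starRingEnd ℂ) v) + deriv g v / g v := by
  have hh : DifferentiableAt ℂ (fun z => (z - (starRingEnd ℂ) v) * g z) v := (differentiableAt_id.sub_const _).mul hg
  rw [newtonValue_eq hh]
  exact logDeriv_mate_split hv hg hg0

/-- its imaginary part: `Im (deriv (dslope F v) v / dslope F v v) = −1/(2·Im v) + Im(g′(v)/g(v))` for `F z = (z − v)·((z − v̄)·g z)`. -/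
theorem im_newtonValue_mate' {g : ℂ → ℂ} {v : ℂ} (hv : v.im ≠ 0) (hg : DifferentiableAt ℂ g v) (hg0 : g v ≠ 0) :
    (deriv (dslope (fun z => (z - v) * ((z - (starRingEnd ℂ) v) * g z)) v) v /
        dslope (fun z => (z - v) * ((z - (starRingEnd ℂ) v) * g z)) v v).im = -1 / (2 * v.im) + (deriv g v / g v).im := by
  rw [newtonValue_mate hv hg hg0, Complex.add_im, mate_term_im v hv]

/-- **LEADING TERM OF THE DROP** (K-2 dictionary line): with `κ = Im K/‖K‖²` and `Im K = −1/(2 Im v) + P` (`P` = pulls),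
`−2·Im v·κ = (1 − 2·Im v·P)/‖K‖²`. -/
theorem main_term_eq (iv nK P : ℝ) (hiv : iv ≠ 0) (hK : nK ≠ 0) :
    -2 * iv * ((-1 / (2 * iv) + P) / nK ^ 2) = (1 - 2 * iv * P) / nK ^ 2 := by
  field_simp
  ring

open RhW08.AntiEscapeSplit7 in
/-- ★ **`newtonK` of a factorised `f⁽ʲ⁾`**: for `f⁽ʲ⁾ = (· − v)·((· − v̄)·g)` with `g` differentiable at `v`, `g v ≠ 0`, `Im v ≠ 0`,
`newtonK f j v = 1/(v − v̄) + g′(v)/g(v)` (mate term + pulls). -/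
theorem newtonK_mate {f g : ℂ → ℂ} {j : ℕ} {v : ℂ} (hv : v.im ≠ 0) (hg : DifferentiableAt ℂ g v) (hg0 : g v ≠ 0)
    (hF : ∀ z : ℂ, iteratedDeriv j f z = (z - v) * ((z - (starRingEnd ℂ) v) * g z)) :
    newtonK f j v = 1 / (v - (starRingEnd ℂ) v) + deriv g v / g v := by
  have e : iteratedDeriv j f = fun z => (z - v) * ((z - (starRingEnd ℂ) v) * g z) := funext hF
  unfold newtonK
  rw [e]
  exact newtonValue_mate hv hg hg0

open RhW08.AntiEscapeSplit7 in
/-- ★ **«Im K_v = −1/(2 Im v) + pulls»** over the tree constant: `Im (newtonK f j v) = −1/(2·Im v) + Im(g′(v)/g(v))`. -/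
theorem im_newtonK_mate {f g : ℂ → ℂ} {j : ℕ} {v : ℂ} (hv : v.im ≠ 0) (hg : DifferentiableAt ℂ g v) (hg0 : g v ≠ 0)
    (hF : ∀ z : ℂ, iteratedDeriv j f z = (z - v) * ((z - (starRingEnd ℂ) v) * g z)) :
    (newtonK f j v).im = -1 / (2 * v.im) + (deriv g v / g v).im := by
  rw [newtonK_mate hv hg hg0 hF, Complex.add_im, mate_term_im v hv]

open RhW08.AntiEscapeSplit7 in
/-- the real part over the tree constant: `Re (newtonK f j v) = Re(g′(v)/g(v))` (the mate contributes nothing horizontally). -/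
theorem re_newtonK_mate {f g : ℂ → ℂ} {j : ℕ} {v : ℂ} (hv : v.im ≠ 0) (hg : DifferentiableAt ℂ g v) (hg0 : g v ≠ 0)
    (hF : ∀ z : ℂ, iteratedDeriv j f z = (z - v) * ((z - (starRingEnd ℂ) v) * g z)) :
    (newtonK f j v).re = (deriv g v / g v).re := by
  rw [newtonK_mate hv hg hg0 hF, Complex.add_re, mate_term_re v, zero_add]

end RhW08.NewtonMate

namespace RhW08.IsolationSign

open Complex

/-- (algebra) cofactor field level-or-down at `v`: `f⁽ʲ⁾ = (·−v)(·−v̄)·g`, `Im(g′/g)(v) ≤ 0`, `0 < Im v` ⇒ `Im K_v ≤ −1/(2·Im v)`. -/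
theorem im_newtonK_le_of_cofactor {f g : ℂ → ℂ} {j : ℕ} {v : ℂ} (hv : 0 < v.im) (hg : DifferentiableAt ℂ g v) (hg0 : g v ≠ 0)
    (hF : ∀ z : ℂ, iteratedDeriv j f z = (z - v) * ((z - (starRingEnd ℂ) v) * g z))
    (hsign : (deriv g v / g v).im ≤ 0) :
    (RhW08.AntiEscapeSplit7.newtonK f j v).im ≤ -(1 / (2 * v.im)) := by
  rw [RhW08.NewtonMate.im_newtonK_mate hv.ne' hg hg0 hF]
  have h : (-1 : ℝ) / (2 * v.im) = -(1 / (2 * v.im)) := by ring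
  linarith

/-- (geometry) zeros of the cofactor in the strip `|Im u| ≤ Hs ≤ R/2`, lateral `R/2`-isolation of `v` from the NON-REAL ones ⇒ `v` lies strictly
outside every closed Jensen disc of `g` (`OffJensenDiscs g v`; strict because `Im v > 0`). -/
theorem offJensenDiscs_of_isolated {g : ℂ → ℂ} {v : ℂ} {R Hs : ℝ} (hv : 0 < v.im) (hHs : Hs ≤ R / 2)
    (hstrip : ∀ u : ℂ, g u = 0 → |u.im| ≤ Hs) (hiso : ∀ u : ℂ, g u = 0 → u.im ≠ 0 → R / 2 ≤ |u.re - v.re|) :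
    StubOffJensenSign.OffJensenDiscs g v := by
  intro u hu him
  have h1 : |u.im| ≤ |u.re - v.re| := le_trans (hstrip u hu) (le_trans hHs (hiso u hu him))
  have h2 : u.im ^ 2 ≤ (u.re - v.re) ^ 2 := sq_le_sq.mpr h1
  have h3 : (u.re - v.re) ^ 2 = (v.re - u.re) ^ 2 := by ring
  have h4 : 0 < v.im ^ 2 := pow_pos hv 2
  linarith

/-- ★ (BY NAME over `offJensenSign_holds`) a simple-pair factorisation `f⁽ʲ⁾ = (·−v)(·−v̄)·g` with a CLASS cofactor `g` (`InClass g Hs`) that has a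
zero, `Hs ≤ R/2`, and lateral `R/2`-isolation of `v` from the non-real zeros of `g` ⇒ the Newton number points STRICTLY down faster than the mate alone:
`Im K_v < −1/(2·Im v)`.  (`g v ≠ 0` is forced: a zero of `g` at `v` would give `R/2 ≤ 0`, hence `Hs ≤ 0`, contradicting `Im v > 0`.) -/
theorem im_newtonK_lt_of_isolated {f g : ℂ → ℂ} {j : ℕ} {v : ℂ} {R Hs : ℝ} (hv : 0 < v.im) (hHs : Hs ≤ R / 2)
    (hF : ∀ z : ℂ, iteratedDeriv j f z = (z - v) * ((z - (starRingEnd ℂ) v) * g z))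
    (hcl : StubOffJensenSign.InClass g Hs) (hex : ∃ u : ℂ, g u = 0)
    (hiso : ∀ u : ℂ, g u = 0 → u.im ≠ 0 → R / 2 ≤ |u.re - v.re|) :
    (RhW08.AntiEscapeSplit7.newtonK f j v).im < -(1 / (2 * v.im)) := by
  have hstrip : ∀ u : ℂ, g u = 0 → |u.im| ≤ Hs := hcl.2.2.2
  have hg0 : g v ≠ 0 := by
    intro h
    have h1 := hiso v h hv.ne'
    rw [sub_self, abs_zero] at h1
    have h2 := hstrip v h
    have h3 : |v.im| = v.im := abs_of_pos hv
    linarith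
  have hne : g ≠ 0 := by
    intro h
    apply hg0
    rw [h]
    rfl
  have hoff : StubOffJensenSign.OffJensenDiscs g v := offJensenDiscs_of_isolated hv hHs hstrip hiso
  have hsign : (deriv g v / g v).im < 0 := offJensenSign_holds g Hs v hcl hne hex hv hoff
  rw [RhW08.NewtonMate.im_newtonK_mate hv.ne' hcl.1.differentiableAt hg0 hF]
  have h : (-1 : ℝ) / (2 * v.im) = -(1 / (2 * v.im)) := by ring
  linarith

/-- the non-strict form (`Im K_v ≤ −1/(2·Im v)`) under the hypotheses of `im_newtonK_lt_of_isolated`. -/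
theorem im_newtonK_le_of_isolated {f g : ℂ → ℂ} {j : ℕ} {v : ℂ} {R Hs : ℝ} (hv : 0 < v.im) (hHs : Hs ≤ R / 2)
    (hF : ∀ z : ℂ, iteratedDeriv j f z = (z - v) * ((z - (starRingEnd ℂ) v) * g z))
    (hcl : StubOffJensenSign.InClass g Hs) (hex : ∃ u : ℂ, g u = 0)
    (hiso : ∀ u : ℂ, g u = 0 → u.im ≠ 0 → R / 2 ≤ |u.re - v.re|) :
    (RhW08.AntiEscapeSplit7.newtonK f j v).im ≤ -(1 / (2 * v.im)) :=
  (im_newtonK_lt_of_isolated hv hHs hF hcl hex hiso).le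

/-- NEWTON-STEP READING: `Im K < 0 ⇒` the first-order child `v − 1/K` lies strictly below `v` (= `(RhW08.UncoveredSign.im_newtonStep_lt_iff _).2`
of the tree's `…R3RateUncoveredSign`, re-derived here to keep the import list at four). -/
theorem im_newtonStep_lt {v K : ℂ} (hK : K.im < 0) : (v - K⁻¹).im < v.im := by
  have hK0 : K ≠ 0 := fun h => by rw [h] at hK; simp at hK
  have hN : 0 < Complex.normSq K := Complex.normSq_pos.2 hK0
  rw [sub_im, inv_im, sub_lt_self_iff, lt_div_iff₀ hN, zero_mul, neg_pos]
  exact hK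

/-- ★ corollary: under the hypotheses of `im_newtonK_lt_of_isolated`, the first-order Newton child of `v` lies strictly below `v`. -/
theorem newtonChild_below_of_isolated {f g : ℂ → ℂ} {j : ℕ} {v : ℂ} {R Hs : ℝ} (hv : 0 < v.im) (hHs : Hs ≤ R / 2)
    (hF : ∀ z : ℂ, iteratedDeriv j f z = (z - v) * ((z - (starRingEnd ℂ) v) * g z))
    (hcl : StubOffJensenSign.InClass g Hs) (hex : ∃ u : ℂ, g u = 0)
    (hiso : ∀ u : ℂ, g u = 0 → u.im ≠ 0 → R / 2 ≤ |u.re - v.re|) :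
    (v - (RhW08.AntiEscapeSplit7.newtonK f j v)⁻¹).im < v.im := by
  apply im_newtonStep_lt
  have h := im_newtonK_lt_of_isolated hv hHs hF hcl hex hiso
  have h2 : 0 < 1 / (2 * v.im) := by positivity
  linarith

open RhIdea6.G17.W07C7 RhIdea6.G17.W07C7.Rev6 RhIdea6.G18.W07C8.Law421BirthS RhIdea6.G19.W07C11.Seam RhIdea6.G20.W07C12.Frac
  RhIdea6.G20.W07C12.StColP RhW07.C12.FieldSplit RhW08.Round1 RhW08.StSwap RhW08.Round2 RhW08.QuadW RhW08.SealSwapQ in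
/-- ★★ **THE ISOLATION SIGN IN THE FRAME (R1uᵀ first lemma)**: on an `EngineHyps5 2` frame, a SIMPLE upper zero `v` of `f⁽ʲ⁾` that is laterally
`R/2`-isolated (every zero of `f⁽ʲ⁾` within lateral distance `< R/2` of `v` is `v` or `v̄`) has Newton number pointing down at least as fast as the
mate alone: `Im K_v ≤ −1/(2·Im v)`.  Chain: class heredity → `RhW08.NestedSign.exists_cofactor` (`f⁽ʲ⁾ = (·−v)(·−v̄)·h`) → simplicity ⇒ `h v ≠ 0`,
Schwarz reflection ⇒ `h v̄ ≠ 0` → isolation + strip `RhW08.Column.abs_im_le_of_level` + `2·Hs ≤ R` ⇒ every zero `a` of `h` has `|Im a| < ‖v − Re a‖`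
→ `RhW08.NestedSign.im_mul_im_logDeriv_nonpos` (Jensen sign, value form, zero-free case included) ⇒ `Im(h′/h)(v) ≤ 0` → `im_newtonK_le_of_cofactor`.
(The simplicity binder is NECESSARY: at a double zero `dslope F v v = F′(v) = 0` and `newtonK` is the junk value `0`.) -/
theorem im_newtonK_le_of_lateral_isolation {η : ℝ} {f : ℂ → ℂ} {x₀ s hmax R Hs : ℝ} {B : ℕ} (hE : EngineHyps5 2 η f x₀ s hmax R Hs B)
    {j : ℕ} {v : ℂ} (hFv : iteratedDeriv j f v = 0) (hsimple : deriv (iteratedDeriv j f) v ≠ 0) (hv : 0 < v.im)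
    (hiso : ∀ z : ℂ, iteratedDeriv j f z = 0 → |z.re - v.re| < R / 2 → z = v ∨ z = (starRingEnd ℂ) v) :
    (RhW08.AntiEscapeSplit7.newtonK f j v).im ≤ -(1 / (2 * v.im)) := by
  have hG := RhW08.WindowLoss.realEntireLt2_iteratedDeriv (RhW08.Column.realEntireLt2_of_hyps hE) j
  obtain ⟨h, hd, ⟨ρ, C, hρ0, hρ, hgr⟩, hreal, hfac⟩ := RhW08.NestedSign.exists_cofactor hG hFv hv.ne'
  -- the factorisation in the mate form
  have e1 : ((v.re : ℂ) + (v.im : ℂ) * I) = v := Complex.re_add_im v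
  have e2 : ((v.re : ℂ) - (v.im : ℂ) * I) = (starRingEnd ℂ) v := by
    apply Complex.ext <;> simp
  have hF : ∀ z : ℂ, iteratedDeriv j f z = (z - v) * ((z - (starRingEnd ℂ) v) * h z) := by
    intro z
    rw [hfac z, RhW08.IsolatedTilt.pairQ_eq_mul, e1, e2]
    ring
  -- simplicity ⇒ `h v ≠ 0`; Schwarz reflection ⇒ `h v̄ ≠ 0`
  have hderiv : deriv (iteratedDeriv j f) v = (v - (starRingEnd ℂ) v) * h v := by
    have e : iteratedDeriv j f = fun z => (z - v) * ((z - (starRingEnd ℂ) v) * h z) := funext hF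
    have hk : DifferentiableAt ℂ (fun z => (z - (starRingEnd ℂ) v) * h z) v :=
      (differentiableAt_id.sub (differentiableAt_const _)).mul hd.differentiableAt
    rw [e, ← dslope_same, RhW08.NewtonMate.dslope_linear_mul hk]
  have hhv : h v ≠ 0 := by
    intro h0
    apply hsimple
    rw [hderiv, h0, mul_zero]
  have hhvbar : h ((starRingEnd ℂ) v) ≠ 0 := by
    rw [Literature.Analysis.Complex.apply_conj_eq_conj hd hreal v, map_ne_zero]
    exact hhv
  -- `f⁽ʲ⁾ ≢ 0`
  have hnz : iteratedDeriv j f ≠ 0 := by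
    intro h0
    apply hsimple
    rw [h0]
    simp
  -- every zero of the cofactor leaves `v` strictly outside its Jensen disc
  have hHsR : 2 * Hs ≤ R := hE.2.2.2.2.2.2.2.2.2.1
  have hout : ∀ a : ℂ, h a = 0 → |a.im| < ‖v - (a.re : ℂ)‖ := by
    intro a ha
    have hGa : iteratedDeriv j f a = 0 := by rw [hF a, ha, mul_zero, mul_zero]
    have hav : a ≠ v := fun e => hhv (e ▸ ha)
    have havb : a ≠ (starRingEnd ℂ) v := fun e => hhvbar (e ▸ ha)
    have hfar : R / 2 ≤ |a.re - v.re| := by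
      refine le_of_not_gt fun hlt => ?_
      rcases hiso a hGa hlt with e | e
      · exact hav e
      · exact havb e
    have hstrip : |a.im| ≤ Hs := RhW08.Column.abs_im_le_of_level hE hnz hGa
    have h1 : |a.im| ≤ |a.re - v.re| := by linarith
    have h2 : a.im ^ 2 ≤ (a.re - v.re) ^ 2 := sq_le_sq.mpr h1
    have hn : ‖v - (a.re : ℂ)‖ ^ 2 = (v.re - a.re) ^ 2 + v.im ^ 2 := by
      rw [← Complex.normSq_eq_norm_sq, Complex.normSq_apply]
      simp
      ring
    have h3 : (a.re - v.re) ^ 2 = (v.re - a.re) ^ 2 := by ring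
    have h4 : |a.im| ^ 2 < ‖v - (a.re : ℂ)‖ ^ 2 := by
      rw [hn, sq_abs]
      nlinarith [pow_pos hv 2]
    exact lt_of_pow_lt_pow_left₀ 2 (norm_nonneg _) h4
  -- JENSEN SIGN (value form) at `v`
  have hsign := RhW08.NestedSign.im_mul_im_logDeriv_nonpos hd hρ0 hρ hgr hreal hhv hout
  have hsign' : (deriv h v / h v).im ≤ 0 :=
    le_of_not_gt fun hc => absurd hsign (not_le.mpr (mul_pos hv hc))
  exact im_newtonK_le_of_cofactor hv hd.differentiableAt hhv hF hsign'

open RhIdea6.G17.W07C7 RhIdea6.G17.W07C7.Rev6 RhIdea6.G18.W07C8.Law421BirthS RhIdea6.G19.W07C11.Seam RhIdea6.G20.W07C12.Frac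
  RhIdea6.G20.W07C12.StColP RhW07.C12.FieldSplit RhW08.Round1 RhW08.StSwap RhW08.Round2 RhW08.QuadW RhW08.SealSwapQ in
/-- corollary: in the frame, under the hypotheses of `im_newtonK_le_of_lateral_isolation`, `Im K_v < 0`, so the first-order Newton child `v − 1/K_v`
lies strictly below `v`. -/
theorem newtonChild_below_of_lateral_isolation {η : ℝ} {f : ℂ → ℂ} {x₀ s hmax R Hs : ℝ} {B : ℕ} (hE : EngineHyps5 2 η f x₀ s hmax R Hs B)
    {j : ℕ} {v : ℂ} (hFv : iteratedDeriv j f v = 0) (hsimple : deriv (iteratedDeriv j f) v ≠ 0) (hv : 0 < v.im)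
    (hiso : ∀ z : ℂ, iteratedDeriv j f z = 0 → |z.re - v.re| < R / 2 → z = v ∨ z = (starRingEnd ℂ) v) :
    (v - (RhW08.AntiEscapeSplit7.newtonK f j v)⁻¹).im < v.im := by
  apply im_newtonStep_lt
  have h := im_newtonK_le_of_lateral_isolation hE hFv hsimple hv hiso
  have h2 : 0 < 1 / (2 * v.im) := by positivity
  linarith

end RhW08.IsolationSign
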